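import Summits.Ventures.YMGap.RobustBall.RobustStarDoorZdVariance
import Summits.Ventures.YMGap.RobustBall.TorusRowsSUNStar
import Summits.Ventures.YMGap.Thresholds.OneLinkVarianceSD
import HarnessLib

/-!
# Venture YMGap, track ROBUST-BALL (Y2) — W15: HYPOTHESIS-FREE `SU(N)` STAR ROWS IN THE PV-VARIANCE FORM (Bakry–Émery Poincaré ×
# engine-2's Schwinger–Dyson variance) — schemas for every `N ≥ 2` and the `SU(3)` cells (torus `d = 4`, Y4 `d = 3`, `ℤ⁴`, `ℤ³`)

HONEST FRAMING. WHAT THIS IS: a venture file (cell `pub-ymgap`, track Y2 ROBUST-BALL, seat ds-2): the robust star doors in VARIANCE FORM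
(`RobustStarDoorVariance`, `RobustStarDoorZdVariance`) fed with the hypothesis-free pair `c_P = 1/(N(1/2−R))` (`oneLinkPoincareSUN_bakryEmery`) and
`v = N(NR/2 + √(1 + N²R²/4))²` (engine-2's `OneLinkVarianceSD.oneLinkVarianceBound_sd`, p2's Schwinger–Dyson second moment; no radius cap), radius
`R = 2(d−1)β_W/N²`: robust coefficient `c ≥ e^{ε₀}·K_s·β_W/N²` with `K_s ≥ √(c_P v) = (NR/2 + √(1+N²R²/4))/√(1/2−R)` (engine-2's `K_PV`) and off-column rows
`λ ≥ e^{ε₀/2}·S_q·ε₁` with `S_q ≥ 1/√(N(1/2−R))` — NO factor `(1 + 2√N ε₁)` and NO `√N` (contrast the Kantorovich route of `TorusRowsSU3Star`). The inner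
square roots are replaced by rational majorants `q₁² ≥ 1 + N²R²/4`, `K_s² ≥ (NR/2 + q₁)²/(1/2−R)`, `S_q² ≥ 1/(N(1/2−R))`, so every row is ONE `norm_num`
certificate. `SU(3)` CELLS (β_W, ε), HYPOTHESIS-FREE, class K: torus `d = 4` tier 1 (`TorusClusteringOnBallUpTo 3 4 (β_W/3) (2ε) ε r A m`) and `ℤ⁴`
(`MassGapOnBallZdG 4 3 (β_W/9) (2ε) ε R`): (1/8, .263) (1/6, .212) (1/5, .170) (1/4, .102) (3/10, .029) — BEFORE (eigen modulus, `TorusRowsSU3Star` /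
`MassGapOnBallZdGRowsSUN`): (1/8, .148) (1/6, .104) (1/5, .069) (1/4, .019), frontier `β_W ≈ 0.27` → now `≈ 0.318`; `d = 3` (Y4 / `ℤ³`): (1/4, .214)
(3/10, .173) (1/3, .144) (2/5, .085) (9/20, .038) — BEFORE (1/4, .106) (3/10, .072) (1/3, .050). WHAT THIS IS NOT: nothing about `SU(3)` beyond the
Bakry–Émery window `R < 1/2`; engine-2's CERTIFIED rows (given H1, H2) reach further (`β_W ≤ 11/20`); radii are door artefacts; nothing about the
continuum or the Millennium problem.

## References
* D. Bakry, M. Émery (1985); the tree: `Thresholds/OneLinkVarianceSD.lean` (engine-2 g9, b75f1d0747e6), `RobustStarDoorVariance`, `RobustStarDoorZdVariance`,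
  `TorusDoorSUNStar` (this seat).
-/

noncomputable section

open Finset
open Literature.MathematicalPhysics.QuantumLattice (fundamentalRep)
open Literature.MathematicalPhysics.QuantumFieldTheory hiding ZdEdge
open Literature.MathematicalPhysics.QuantumFieldTheory.Balaban1983to89.StrongCouplingTorusWindow
open Summit.QuantumFields.BalabanUV.InfraRed.StrongCouplingPoincareDoorSUN (OneLinkPoincareSUN oneLinkPoincareSUN_bakryEmery)
open Summit.QuantumFields.BalabanUV.InfraRed.StrongCouplingVarianceDoorSUN (OneLinkVarianceBound)
open Summit.Ventures.YMGap.OneLinkVarianceSD (oneLinkVarianceBound_sd)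
open Summit.Ventures.YMGap.StarResolventDim (Delta gaugeR doorPoly Delta_pos_of_door gaugeR_lt_one_of_door)

namespace Summit.Ventures.YMGap.RobustBall

variable {N : ℕ}

/-! ### The PV-variance inputs with rational majorants -/

/-- The two door inputs from the pair (Bakry–Émery Poincaré, Schwinger–Dyson variance) on the radius `R < 1/2`, bounded by rational majorants:
`e^{ε₀}√(c_P v)·x ≤ E K_s x` and `e^{ε₀/2}√c_P ε₁ ≤ E₂ S_q ε₁` whenever `q₁² ≥ 1 + N²R²/4`, `K_s² ≥ (NR/2 + q₁)²/(1/2−R)`, `S_q² ≥ 1/(N(1/2−R))`. [folklore] -/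
theorem pvVariance_star_inputs (hN : 2 ≤ N) {R ε₀ ε₁ E E₂ q₁ Ks Sq x : ℝ} (hR0 : 0 ≤ R) (hR : R < 1 / 2) (hε₁ : 0 ≤ ε₁) (hx : 0 ≤ x)
    (hE : Real.exp ε₀ ≤ E) (hE₂ : Real.exp (ε₀ / 2) ≤ E₂) (hq₁0 : 0 ≤ q₁) (hq₁ : 1 + (N : ℝ) ^ 2 * R ^ 2 / 4 ≤ q₁ ^ 2)
    (hKs0 : 0 ≤ Ks) (hKs : ((N : ℝ) * R / 2 + q₁) ^ 2 / (1 / 2 - R) ≤ Ks ^ 2) (hSq0 : 0 ≤ Sq) (hSq : 1 / ((N : ℝ) * (1 / 2 - R)) ≤ Sq ^ 2) :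
    Real.exp ε₀ * Real.sqrt (1 / ((N : ℝ) * (1 / 2 - R)) * ((N : ℝ) * ((N : ℝ) * R / 2 + Real.sqrt (1 + (N : ℝ) ^ 2 * R ^ 2 / 4)) ^ 2)) * x ≤
        E * Ks * x ∧
      Real.exp (ε₀ / 2) * Real.sqrt (1 / ((N : ℝ) * (1 / 2 - R))) * ε₁ ≤ E₂ * Sq * ε₁ := by
  have hN0 : (0 : ℝ) < N := by exact_mod_cast (show 0 < N by omega)
  have hgap : 0 < 1 / 2 - R := by linarith
  have hE0 : 0 ≤ E := (Real.exp_pos _).le.trans hE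
  have hE20 : 0 ≤ E₂ := (Real.exp_pos _).le.trans hE₂
  -- the inner square root
  have hin : Real.sqrt (1 + (N : ℝ) ^ 2 * R ^ 2 / 4) ≤ q₁ := by
    rw [← Real.sqrt_sq hq₁0]; exact Real.sqrt_le_sqrt hq₁
  have hin0 : 0 ≤ (N : ℝ) * R / 2 + Real.sqrt (1 + (N : ℝ) ^ 2 * R ^ 2 / 4) := by positivity
  -- `c_P v = (NR/2 + √…)²/(1/2−R) ≤ Ks²`
  have hcv : 1 / ((N : ℝ) * (1 / 2 - R)) * ((N : ℝ) * ((N : ℝ) * R / 2 + Real.sqrt (1 + (N : ℝ) ^ 2 * R ^ 2 / 4)) ^ 2) =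
      ((N : ℝ) * R / 2 + Real.sqrt (1 + (N : ℝ) ^ 2 * R ^ 2 / 4)) ^ 2 / (1 / 2 - R) := by
    field_simp
  have hKs' : Real.sqrt (1 / ((N : ℝ) * (1 / 2 - R)) * ((N : ℝ) * ((N : ℝ) * R / 2 + Real.sqrt (1 + (N : ℝ) ^ 2 * R ^ 2 / 4)) ^ 2)) ≤ Ks := by
    rw [hcv, ← Real.sqrt_sq hKs0]
    refine Real.sqrt_le_sqrt (le_trans ?_ hKs)
    refine div_le_div_of_nonneg_right ?_ hgap.le
    exact pow_le_pow_left₀ hin0 (by linarith) 2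
  have hSq' : Real.sqrt (1 / ((N : ℝ) * (1 / 2 - R))) ≤ Sq := by
    rw [← Real.sqrt_sq hSq0]; exact Real.sqrt_le_sqrt hSq
  refine ⟨?_, ?_⟩
  · exact mul_le_mul_of_nonneg_right (mul_le_mul hE hKs' (Real.sqrt_nonneg _) hE0) hx
  · exact mul_le_mul_of_nonneg_right (mul_le_mul hE₂ hSq' (Real.sqrt_nonneg _) hE20) hε₁

/-! ### Schemas, every `N ≥ 2` (PV-variance form) -/

/-- **SCHEMA, `d = 4` torus, tier 1, every `N ≥ 2`, PV-variance form** (Wilson `β_W`, tree `β_W/N`, radius `R = 6β_W/N² < 1/2`): the rational certificate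
gives `TorusClusteringOnBallUpTo N 4 (β_W/N) ε₀ ε₁ r A m` for some `m > 0`. [folklore] -/
theorem suN_torusClusteringOnBallUpTo_star_pv (Kn : ℕ) (hN : 2 ≤ N) {βW ε₀ ε₁ c lam E E₂ q₁ Ks Sq : ℝ} (hβ0 : 0 < βW)
    (hR : βW / (N : ℝ) ^ 2 * 6 < 1 / 2) (hε₁ : 0 ≤ ε₁) (hE : Real.exp ε₀ ≤ E) (hE₂ : Real.exp (ε₀ / 2) ≤ E₂) (hq₁0 : 0 ≤ q₁)
    (hq₁ : 1 + (N : ℝ) ^ 2 * (βW / (N : ℝ) ^ 2 * 6) ^ 2 / 4 ≤ q₁ ^ 2) (hKs0 : 0 ≤ Ks)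
    (hKs : ((N : ℝ) * (βW / (N : ℝ) ^ 2 * 6) / 2 + q₁) ^ 2 / (1 / 2 - βW / (N : ℝ) ^ 2 * 6) ≤ Ks ^ 2) (hSq0 : 0 ≤ Sq)
    (hSq : 1 / ((N : ℝ) * (1 / 2 - βW / (N : ℝ) ^ 2 * 6)) ≤ Sq ^ 2) (hc : E * Ks * (βW / (N : ℝ) ^ 2) ≤ c)
    (hlam : E₂ * Sq * ε₁ ≤ lam) (hθ1 : 6 * c + lam < 1) (hcd : doorPoly 4 c < 1)
    (hρ1 : gaugeR 4 c + (lam + (6 * c + lam) ^ Kn * (16 * lam)) / (1 - (6 * c + lam)) < 1) (r : ℕ) :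
    ∃ A m : ℝ, 0 < m ∧ TorusClusteringOnBallUpTo N 4 (βW / N) ε₀ ε₁ r A m := by
  have hN1 : 1 ≤ N := by omega
  have hN0 : (0 : ℝ) < N := by exact_mod_cast (show 0 < N by omega)
  set R : ℝ := βW / (N : ℝ) ^ 2 * 6 with hRdef
  have hR0 : 0 ≤ R := by positivity
  have hgap : 0 < 1 / 2 - R := by linarith
  have hP := oneLinkPoincareSUN_bakryEmery hN hR
  have hV := oneLinkVarianceBound_sd hN1 R
  obtain ⟨h1, h2⟩ := pvVariance_star_inputs hN (x := βW / (N : ℝ) ^ 2) hR0 hR hε₁ (by positivity) hE hE₂ hq₁0 hq₁ hKs0 hKs hSq0 hSq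
  have hc0 : 0 ≤ c := le_trans (le_trans (by positivity) h1) hc
  have hE20 : 0 ≤ E₂ := (Real.exp_pos _).le.trans hE₂
  have hlam0 : 0 ≤ lam := le_trans (by positivity) hlam
  set θ : ℝ := 6 * c + lam with hθ
  set ρ : ℝ := gaugeR 4 c + (lam + θ ^ Kn * (16 * lam)) / (1 - θ) with hρ
  have hθ0 : 0 ≤ θ := by positivity
  have hgR := gaugeR_lt_one_of_door (d := 4) (by norm_num) hc0 hcd
  have hρ0 : 0 ≤ ρ := by
    have : 0 ≤ θ ^ Kn := pow_nonneg hθ0 Kn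
    have h1' : 0 < 1 - θ := by linarith
    rw [hρ]; exact add_nonneg hgR.1 (div_nonneg (by positivity) h1'.le)
  have hβN : βW / (N : ℝ) / (N : ℝ) = βW / (N : ℝ) ^ 2 := by rw [div_div, sq]
  have hb' : βW / (N : ℝ) / (N : ℝ) * (2 * (((4 : ℕ) : ℝ) - 1)) ≤ R := by rw [hβN, hRdef]; norm_num
  have hc' : Real.exp ε₀ * Real.sqrt (1 / ((N : ℝ) * (1 / 2 - R)) *
      ((N : ℝ) * ((N : ℝ) * R / 2 + Real.sqrt (1 + (N : ℝ) ^ 2 * R ^ 2 / 4)) ^ 2)) * (βW / (N : ℝ) / (N : ℝ)) ≤ c := by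
    rw [hβN]; exact h1.trans hc
  have hθ' : θ = (2 * ((4 : ℕ) : ℝ) - 2) * c + lam := by rw [hθ]; push_cast; ring
  have hρ' : ρ = gaugeR 4 c + (lam + θ ^ Kn * (4 * ((4 : ℕ) : ℝ) * lam)) / (1 - θ) := by rw [hρ]; push_cast; ring
  have h := torusClusteringOnBallUpTo_of_robustStar_variance (d := 4) (N := N) (by norm_num) hN1 r Kn (by positivity) (by positivity)
    hb' hP hV hε₁ hc' (h2.trans hlam) hθ' hθ1 hcd hρ' hρ1
  refine ⟨_, _, ?_, h⟩
  have h1' : 0 < 1 - ρ := by linarith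
  have hden : 0 < 2 * (2 * ρ * ((2 * 4 : ℕ) : ℝ) + 1) := by push_cast; nlinarith
  positivity

/-- **SCHEMA, `d = 3`, every `N ≥ 2`, PV-variance form**: Y4's `ClusterDomainClustering` on `ClusterDomainFR ε₀ ε₁ r` up to `β_W/N` (radius
`R = 4β_W/N²`; door `8c² + 6c < 1`, `θ = 4c + λ`), plus the torus form. [folklore] -/
theorem suN_clusterDomainClustering_dim3_star_pv (Kn : ℕ) (hN : 2 ≤ N) {βW ε₀ ε₁ c lam E E₂ q₁ Ks Sq : ℝ} (hβ0 : 0 < βW)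
    (hR : βW / (N : ℝ) ^ 2 * 4 < 1 / 2) (hε₁ : 0 ≤ ε₁) (hE : Real.exp ε₀ ≤ E) (hE₂ : Real.exp (ε₀ / 2) ≤ E₂) (hq₁0 : 0 ≤ q₁)
    (hq₁ : 1 + (N : ℝ) ^ 2 * (βW / (N : ℝ) ^ 2 * 4) ^ 2 / 4 ≤ q₁ ^ 2) (hKs0 : 0 ≤ Ks)
    (hKs : ((N : ℝ) * (βW / (N : ℝ) ^ 2 * 4) / 2 + q₁) ^ 2 / (1 / 2 - βW / (N : ℝ) ^ 2 * 4) ≤ Ks ^ 2) (hSq0 : 0 ≤ Sq)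
    (hSq : 1 / ((N : ℝ) * (1 / 2 - βW / (N : ℝ) ^ 2 * 4)) ≤ Sq ^ 2) (hc : E * Ks * (βW / (N : ℝ) ^ 2) ≤ c)
    (hlam : E₂ * Sq * ε₁ ≤ lam) (hθ1 : 4 * c + lam < 1) (hcd : doorPoly 3 c < 1)
    (hρ1 : gaugeR 3 c + (lam + (4 * c + lam) ^ Kn * (12 * lam)) / (1 - (4 * c + lam)) < 1) (r : ℕ) :
    ∃ m : ℝ, 0 < m ∧
      YM3IR.ClusterDomainClustering (G := SUN N)
        ⟨fundamentalRep (Fin N), βW / N, fun _ _ W => W ∈ ClusterDomainFR ε₀ ε₁ r⟩ suFrobDist m ∧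
      ∃ A : ℝ, TorusClusteringOnBallUpTo N 3 (βW / N) ε₀ ε₁ r A m := by
  have hN1 : 1 ≤ N := by omega
  have hN0 : (0 : ℝ) < N := by exact_mod_cast (show 0 < N by omega)
  set R : ℝ := βW / (N : ℝ) ^ 2 * 4 with hRdef
  have hR0 : 0 ≤ R := by positivity
  have hgap : 0 < 1 / 2 - R := by linarith
  have hP := oneLinkPoincareSUN_bakryEmery hN hR
  have hV := oneLinkVarianceBound_sd hN1 R
  obtain ⟨h1, h2⟩ := pvVariance_star_inputs hN (x := βW / (N : ℝ) ^ 2) hR0 hR hε₁ (by positivity) hE hE₂ hq₁0 hq₁ hKs0 hKs hSq0 hSq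
  have hc0 : 0 ≤ c := le_trans (le_trans (by positivity) h1) hc
  have hE20 : 0 ≤ E₂ := (Real.exp_pos _).le.trans hE₂
  have hlam0 : 0 ≤ lam := le_trans (by positivity) hlam
  set θ : ℝ := 4 * c + lam with hθ
  set ρ : ℝ := gaugeR 3 c + (lam + θ ^ Kn * (12 * lam)) / (1 - θ) with hρ
  have hθ0 : 0 ≤ θ := by positivity
  have hgR := gaugeR_lt_one_of_door (d := 3) (by norm_num) hc0 hcd
  have hρ0 : 0 ≤ ρ := by
    have : 0 ≤ θ ^ Kn := pow_nonneg hθ0 Kn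
    have h1' : 0 < 1 - θ := by linarith
    rw [hρ]; exact add_nonneg hgR.1 (div_nonneg (by positivity) h1'.le)
  have hβN : βW / (N : ℝ) / (N : ℝ) = βW / (N : ℝ) ^ 2 := by rw [div_div, sq]
  have hb4 : βW / (N : ℝ) / (N : ℝ) * 4 ≤ R := by rw [hβN, hRdef]
  have hb' : βW / (N : ℝ) / (N : ℝ) * (2 * (((3 : ℕ) : ℝ) - 1)) ≤ R := by rw [hβN, hRdef]; norm_num
  have hc' : Real.exp ε₀ * Real.sqrt (1 / ((N : ℝ) * (1 / 2 - R)) *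
      ((N : ℝ) * ((N : ℝ) * R / 2 + Real.sqrt (1 + (N : ℝ) ^ 2 * R ^ 2 / 4)) ^ 2)) * (βW / (N : ℝ) / (N : ℝ)) ≤ c := by
    rw [hβN]; exact h1.trans hc
  have hθ' : θ = (2 * ((3 : ℕ) : ℝ) - 2) * c + lam := by rw [hθ]; push_cast; ring
  have hρ' : ρ = gaugeR 3 c + (lam + θ ^ Kn * (4 * ((3 : ℕ) : ℝ) * lam)) / (1 - θ) := by rw [hρ]; push_cast; ring
  have hm : 0 < (1 - ρ) ^ 2 / (2 * (2 * ρ * ((2 * 3 : ℕ) : ℝ) + 1)) / ((max r 1 + 2 : ℕ) : ℝ) := by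
    have h1' : 0 < 1 - ρ := by linarith
    have hden : 0 < 2 * (2 * ρ * ((2 * 3 : ℕ) : ℝ) + 1) := by push_cast; nlinarith
    positivity
  refine ⟨_, hm, clusterDomainClustering_dim3_of_robustStar_variance (N := N) hN1 r Kn (by positivity) (by positivity) hb4 hP hV hε₁
    hc' (h2.trans hlam) hθ hθ1 hcd hρ hρ1, _,
    torusClusteringOnBallUpTo_of_robustStar_variance (d := 3) (N := N) (by norm_num) hN1 r Kn (by positivity) (by positivity) hb' hP hV hε₁
      hc' (h2.trans hlam) hθ' hθ1 hcd hρ' hρ1⟩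

/-- **SCHEMA, `ℤ⁴`, every `N ≥ 2`, PV-variance form** (tree coupling `β_W/N²`, radius `6β_W/N²`): `MassGapOnBallZdG 4 N (β_W/N²) ε₀ ε₁ R`. [folklore] -/
theorem suN_massGapOnBallZdG_star_pv (Kn : ℕ) (hN : 2 ≤ N) {βW ε₀ ε₁ c lam E E₂ q₁ Ks Sq : ℝ} (hβ0 : 0 < βW)
    (hR : βW / (N : ℝ) ^ 2 * 6 < 1 / 2) (hε₁ : 0 ≤ ε₁) (hE : Real.exp ε₀ ≤ E) (hE₂ : Real.exp (ε₀ / 2) ≤ E₂) (hq₁0 : 0 ≤ q₁)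
    (hq₁ : 1 + (N : ℝ) ^ 2 * (βW / (N : ℝ) ^ 2 * 6) ^ 2 / 4 ≤ q₁ ^ 2) (hKs0 : 0 ≤ Ks)
    (hKs : ((N : ℝ) * (βW / (N : ℝ) ^ 2 * 6) / 2 + q₁) ^ 2 / (1 / 2 - βW / (N : ℝ) ^ 2 * 6) ≤ Ks ^ 2) (hSq0 : 0 ≤ Sq)
    (hSq : 1 / ((N : ℝ) * (1 / 2 - βW / (N : ℝ) ^ 2 * 6)) ≤ Sq ^ 2) (hc : E * Ks * (βW / (N : ℝ) ^ 2) ≤ c)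
    (hlam : E₂ * Sq * ε₁ ≤ lam) (hθ1 : 6 * c + lam < 1) (hcd : doorPoly 4 c < 1)
    (hρ1 : gaugeR 4 c + (lam + (6 * c + lam) ^ Kn * (16 * lam)) / (1 - (6 * c + lam)) < 1) (Rr : ℕ) :
    MassGapOnBallZdG 4 N (βW / (N : ℝ) ^ 2) ε₀ ε₁ Rr := by
  have hN1 : 1 ≤ N := by omega
  have hN0 : (0 : ℝ) < N := by exact_mod_cast (show 0 < N by omega)
  set R : ℝ := βW / (N : ℝ) ^ 2 * 6 with hRdef
  have hR0 : 0 ≤ R := by positivity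
  have hP := oneLinkPoincareSUN_bakryEmery hN hR
  have hV := oneLinkVarianceBound_sd hN1 R
  obtain ⟨h1, h2⟩ := pvVariance_star_inputs hN (x := βW / (N : ℝ) ^ 2) hR0 hR hε₁ (by positivity) hE hE₂ hq₁0 hq₁ hKs0 hKs hSq0 hSq
  have htN : |(N : ℝ) * (βW / (N : ℝ) ^ 2)| / N = βW / (N : ℝ) ^ 2 := by rw [abs_of_nonneg (by positivity)]; field_simp
  have hb' : |(N : ℝ) * (βW / (N : ℝ) ^ 2)| / N * (2 * (((4 : ℕ) : ℝ) - 1)) ≤ R := by rw [htN, hRdef]; norm_num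
  have hc' : Real.exp ε₀ * Real.sqrt (1 / ((N : ℝ) * (1 / 2 - R)) *
      ((N : ℝ) * ((N : ℝ) * R / 2 + Real.sqrt (1 + (N : ℝ) ^ 2 * R ^ 2 / 4)) ^ 2)) * (|(N : ℝ) * (βW / (N : ℝ) ^ 2)| / N) ≤ c := by
    rw [htN]; exact h1.trans hc
  have hθ' : (6 : ℝ) * c + lam = (2 * ((4 : ℕ) : ℝ) - 2) * c + lam := by push_cast; ring
  have hρ' : gaugeR 4 c + (lam + (6 * c + lam) ^ Kn * (16 * lam)) / (1 - (6 * c + lam)) =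
      gaugeR 4 c + (lam + (6 * c + lam) ^ Kn * (4 * ((4 : ℕ) : ℝ) * lam)) / (1 - (6 * c + lam)) := by push_cast; ring
  exact massGapOnBallZdG_of_robustStar_variance (d := 4) (N := N) (by norm_num) hN1 (Kn := Kn) (by positivity) (by positivity)
    hb' hP hV hε₁ hc' (h2.trans hlam) hθ' hθ1 hcd hρ' hρ1

/-- **SCHEMA, `ℤ³`, every `N ≥ 2`, PV-variance form** (tree coupling `β_W/N²`, radius `4β_W/N²`): `MassGapOnBallZdG 3 N (β_W/N²) ε₀ ε₁ R`. [folklore] -/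
theorem suN_massGapOnBallZdG_dim3_star_pv (Kn : ℕ) (hN : 2 ≤ N) {βW ε₀ ε₁ c lam E E₂ q₁ Ks Sq : ℝ} (hβ0 : 0 < βW)
    (hR : βW / (N : ℝ) ^ 2 * 4 < 1 / 2) (hε₁ : 0 ≤ ε₁) (hE : Real.exp ε₀ ≤ E) (hE₂ : Real.exp (ε₀ / 2) ≤ E₂) (hq₁0 : 0 ≤ q₁)
    (hq₁ : 1 + (N : ℝ) ^ 2 * (βW / (N : ℝ) ^ 2 * 4) ^ 2 / 4 ≤ q₁ ^ 2) (hKs0 : 0 ≤ Ks)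
    (hKs : ((N : ℝ) * (βW / (N : ℝ) ^ 2 * 4) / 2 + q₁) ^ 2 / (1 / 2 - βW / (N : ℝ) ^ 2 * 4) ≤ Ks ^ 2) (hSq0 : 0 ≤ Sq)
    (hSq : 1 / ((N : ℝ) * (1 / 2 - βW / (N : ℝ) ^ 2 * 4)) ≤ Sq ^ 2) (hc : E * Ks * (βW / (N : ℝ) ^ 2) ≤ c)
    (hlam : E₂ * Sq * ε₁ ≤ lam) (hθ1 : 4 * c + lam < 1) (hcd : doorPoly 3 c < 1)
    (hρ1 : gaugeR 3 c + (lam + (4 * c + lam) ^ Kn * (12 * lam)) / (1 - (4 * c + lam)) < 1) (Rr : ℕ) :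
    MassGapOnBallZdG 3 N (βW / (N : ℝ) ^ 2) ε₀ ε₁ Rr := by
  have hN1 : 1 ≤ N := by omega
  have hN0 : (0 : ℝ) < N := by exact_mod_cast (show 0 < N by omega)
  set R : ℝ := βW / (N : ℝ) ^ 2 * 4 with hRdef
  have hR0 : 0 ≤ R := by positivity
  have hP := oneLinkPoincareSUN_bakryEmery hN hR
  have hV := oneLinkVarianceBound_sd hN1 R
  obtain ⟨h1, h2⟩ := pvVariance_star_inputs hN (x := βW / (N : ℝ) ^ 2) hR0 hR hε₁ (by positivity) hE hE₂ hq₁0 hq₁ hKs0 hKs hSq0 hSq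
  have htN : |(N : ℝ) * (βW / (N : ℝ) ^ 2)| / N = βW / (N : ℝ) ^ 2 := by rw [abs_of_nonneg (by positivity)]; field_simp
  have hb' : |(N : ℝ) * (βW / (N : ℝ) ^ 2)| / N * (2 * (((3 : ℕ) : ℝ) - 1)) ≤ R := by rw [htN, hRdef]; norm_num
  have hc' : Real.exp ε₀ * Real.sqrt (1 / ((N : ℝ) * (1 / 2 - R)) *
      ((N : ℝ) * ((N : ℝ) * R / 2 + Real.sqrt (1 + (N : ℝ) ^ 2 * R ^ 2 / 4)) ^ 2)) * (|(N : ℝ) * (βW / (N : ℝ) ^ 2)| / N) ≤ c := by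
    rw [htN]; exact h1.trans hc
  have hθ' : (4 : ℝ) * c + lam = (2 * ((3 : ℕ) : ℝ) - 2) * c + lam := by push_cast; ring
  have hρ' : gaugeR 3 c + (lam + (4 * c + lam) ^ Kn * (12 * lam)) / (1 - (4 * c + lam)) =
      gaugeR 3 c + (lam + (4 * c + lam) ^ Kn * (4 * ((3 : ℕ) : ℝ) * lam)) / (1 - (4 * c + lam)) := by push_cast; ring
  exact massGapOnBallZdG_of_robustStar_variance (d := 3) (N := N) (by norm_num) hN1 (Kn := Kn) (by positivity) (by positivity)
    hb' hP hV hε₁ hc' (h2.trans hlam) hθ' hθ1 hcd hρ' hρ1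

end Summit.Ventures.YMGap.RobustBall

end
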